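import Summits.ResolutionOfSingularities.ResolutionOfSingularities.Theorems.WeightedInvariantSuccessorRatioBoundContact
import Summits.ResolutionOfSingularities.ResolutionOfSingularities.Theorems.AQSHeightTwoSlopeFiltration
import HarnessLib

/-!
# (o56)(b′) ring side, PART 2 of 6 — the MONOMIAL READING, 𝔪^N-STABILITY of rational contact, RATIO MONOTONICITY, and RESIDUE REPRESENTATIVES

**Provenance / honest framing.** This is a VERBATIM PORT (proofs unchanged; namespace `…LocalEngine.Iota3.RatContact` instead of the sketch's
`…Iota3.R9`) of res-L1-w43-idea-2's kernel-checked sketch `Cruxes/WeightedConstruction/SketchL1w43Idea2R9.lean` (Sketch-R9, gen 9, tree copy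
b7197eb188e64d8c = 657de2227c79926d + the §15 unit-factor lemma; §14e as announced f30a0aee35c844fc), board item (o56-R9) of res-L1-w43-plan-1 (dealer word STATUS l.69360), res-plan-2 IDLE POOL
DEAL #52 (2); ported by res-L1-type-o4 so that `Theorems/` files (res-type-057's (D1) bundle for the door item `stmt-ResolutionOfSingularities-19897`
branch (o56)(b′)) can import it; `--supports stmt-ResolutionOfSingularities-0571 --as helper`. [OURS · L1 w43 · idea-2 R9] Every statement here is OURS
elementary commutative algebra over Mathlib and the tree's `flagContactFiltration` / `weightedMonomialIdeal` / unit-expansion calculus; every `def` is an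
OURS notion of the sketch (NOT a statement of H. Hironaka's 2017 manuscript, which is under adjudication and is neither asserted nor used); no Literature
fact is introduced; AI-written and AI-ported, weaker than expert review; nothing here is progress on resolution of singularities in positive characteristic.

## Contents (Sketch-R9 §8, §11, §12 (ratio monotonicity; representatives) verbatim)
* §8 MONOMIAL READING (`mem_weightedMonomialIdeal_iff_forall_le_weight`, `weight_ge_iff_point_ge`; from the tree's `Theorems.LocalGameEFTNewton.*`).
* §11 `ratContactFiltration_congr_mod_pow`: `g ≡ g″ (mod 𝔪^N)`, `a ≤ bN` ⇒ `RC(g;a,b;n) = RC(g″;a,b;n)` (ceiling arithmetic: the tree's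
  `Theorems.AQSHeightTwo.cdiv_le_of_le_mul` and `Iota3.range_vec₃` are REUSED, not restated — gate dedup p561380).
* §12a `ratContactFiltration_mono_ratio`: rational contact is monotone in the ratio `a/b`.
* §12c `ratContactFiltration_unit_mul`, `nonmem_of_representatives` (only the translates `Y − c·t`, `c ∈ Λ` a set of residue
  representatives, matter), `low_weight`.
-/

noncomputable section

open IsLocalRing Literature.AlgebraicGeometry.Resolution

set_option linter.dupNamespace false

namespace Summit.ResolutionOfSingularities.ResolutionOfSingularities.Cruxes.HypersurfaceCentreConstruction.LocalEngine

namespace Iota3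

namespace RatContact

universe u

/-! ## §8 (G1) The monomial reading of the certificate hypothesis

`δ(Δ(f;u;g)) ≥ a/b` is, on any UNIT MONOMIAL EXPANSION `f ≡ Σ_{α∈Δ} a_α u₃^{α₀} u₂^{α₁} g^{α₂} (mod 𝔪^N)` (tree:
`Theorems.LocalGameEFTNewton.exists_unitExpansion`), the condition `b(α₀+α₁) + a·α₂ ≥ aν` for every `α ∈ Δ` — i.e. every point
`(α₀+α₁)/(ν−α₂)` of the polyhedron lies at abscissa `≥ a/b`.  The tree's «unit monomials cannot hide»
(`le_weight_of_mem_weightedMonomialIdeal`, regular frame) and its easy converse give the iff below; so (G1) is closed for the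
door modulo producing the expansion, which `exists_unitExpansion` does. -/

section MonomialReading

variable {T : Type u} [CommRing T] [IsRegularLocalRing T]

/-- [OURS · R9 · (G1)] **Weighted-ideal membership = polyhedron condition on a unit expansion** (frame `(u₃,u₂,g)`, weights
`(b,b,a)`, regular local ring of dimension 3). [cite: Matsumura1987, Thm. 16.2] -/
theorem mem_weightedMonomialIdeal_iff_forall_le_weight (hdim : ringKrullDim T = (3 : ℕ)) {u₃ u₂ g f : T} {a b n N : ℕ}
    (h𝔪 : Ideal.span (Set.range ![u₃, u₂, g]) = maximalIdeal T) (hb : 0 < b) (ha : 0 < a)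
    {Δ : Finset (Fin 3 → ℕ)} {c : (Fin 3 → ℕ) → T} (hunit : ∀ α ∈ Δ, IsUnit (c α))
    (hr : f - ∑ α ∈ Δ, c α * ∏ i, ![u₃, u₂, g] i ^ α i ∈ maximalIdeal T ^ N) (hnN : n ≤ N) :
    f ∈ weightedMonomialIdeal ![u₃, u₂, g] ![b, b, a] n ↔ ∀ α ∈ Δ, n ≤ ∑ i, ![b, b, a] i * α i := by
  have hw : ∀ i, 0 < (![b, b, a] : Fin 3 → ℕ) i := by
    intro i; fin_cases i <;> simp [hb, ha]
  constructor
  · intro hf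
    exact Theorems.LocalGameEFTNewton.le_weight_of_mem_weightedMonomialIdeal ![u₃, u₂, g] h𝔪 hdim ![b, b, a] hw hunit hr hf hnN
  · intro hge
    exact Theorems.LocalGameEFTNewton.mem_weightedMonomialIdeal_of_forall_le_weight ![u₃, u₂, g] h𝔪 ![b, b, a] hw hr hge hnN

/-- [OURS · R9 · (G1)] The polyhedron form: with `n = aν`, the weight condition on an exponent `α` with `α₂ < ν` reads
`a(ν − α₂) ≤ b(α₀ + α₁)`, i.e. the point `(α₀+α₁)/(ν−α₂)` of `Δ(f;u;g)` has abscissa `≥ a/b`. [folklore] -/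
theorem weight_ge_iff_point_ge (a b ν : ℕ) (α : Fin 3 → ℕ) (hα : α 2 ≤ ν) :
    a * ν ≤ ∑ i, ![b, b, a] i * α i ↔ a * (ν - α 2) ≤ b * (α 0 + α 1) := by
  obtain ⟨k, hk⟩ := Nat.exists_eq_add_of_le hα
  simp only [Fin.sum_univ_three, Matrix.cons_val_zero, Matrix.cons_val_one, Matrix.cons_val_two, Matrix.tail_cons,
    Matrix.head_cons]
  rw [hk, Nat.add_sub_cancel_left]
  constructor <;> intro h <;> nlinarith

end MonomialReading

/-! ## §11 𝔪^N-stability of rational contact (the second half of the in-`S` replacement of (G2))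

`g ≡ g″ (mod 𝔪^N)` with `a ≤ bN` ⇒ `RC(g; a,b; n) = RC(g″; a,b; n)` for all `n`: a competitor may be replaced by any
`𝔪^N`-approximation — e.g. by `v_N·(Y − φ_N(t,z))` from an approximate IFT — without changing a single contact ideal. -/

section Stability

variable {S : Type u} [CommRing S] [IsLocalRing S]

/-- Ceiling subadditivity `⌈(X+Y)/b⌉ ≤ ⌈X/b⌉ + ⌈Y/b⌉`, in `ℕ`-division form. [folklore] -/
theorem ceilDiv_add_le (X Y : ℕ) {b : ℕ} (hb : 0 < b) :
    (X + Y + b - 1) / b ≤ (X + b - 1) / b + (Y + b - 1) / b := by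
  set A := (X + b - 1) / b with hA
  set B := (Y + b - 1) / b with hB
  have hX : X + b - 1 < A * b + b := Nat.lt_div_mul_add hb
  have hY : Y + b - 1 < B * b + b := Nat.lt_div_mul_add hb
  have h1 : X ≤ A * b := by omega
  have h2 : Y ≤ B * b := by omega
  have key : X + Y + b - 1 < (A + B + 1) * b := by
    have : (A + B + 1) * b = A * b + B * b + b := by ring
    omega
  exact Nat.lt_succ_iff.mp ((Nat.div_lt_iff_lt_mul hb).mpr key)

/-- The exponent bookkeeping: `e(i) ≤ e(α) + N(α − i)` for `i ≤ α`, `e(x) = ⌈(n − ax)/b⌉`, when `a ≤ bN`. [folklore] -/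
theorem ceil_exponent_shift {a b N : ℕ} (hb : 0 < b) (hN : a ≤ b * N) (n : ℕ) {i α : ℕ} (hi : i ≤ α) :
    (n - a * i + b - 1) / b ≤ (n - a * α + b - 1) / b + N * (α - i) := by
  have hsplit : a * α = a * i + a * (α - i) := by
    rw [← mul_add]; congr 1; omega
  have hP : n - a * i ≤ (n - a * α) + a * (α - i) := by omega
  calc (n - a * i + b - 1) / b ≤ ((n - a * α) + a * (α - i) + b - 1) / b :=
        Nat.div_le_div_right (by omega)
    _ ≤ ((n - a * α) + b - 1) / b + (a * (α - i) + b - 1) / b := ceilDiv_add_le _ _ hb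
    _ ≤ (n - a * α + b - 1) / b + N * (α - i) := by
        have hle : a * (α - i) ≤ b * (N * (α - i)) := by
          calc a * (α - i) ≤ (b * N) * (α - i) := Nat.mul_le_mul_right _ hN
            _ = b * (N * (α - i)) := by ring
        exact Nat.add_le_add_left (Theorems.AQSHeightTwo.cdiv_le_of_le_mul hb hle) _

/-- [OURS · R9 · (G2″)] **`𝔪^N`-stability of rational contact, one inclusion**: `g″ − g ∈ 𝔪^N`, `a ≤ bN` ⇒ `RC(g″) ≤ RC(g)`. [folklore] -/
theorem ratContactFiltration_le_of_sub_mem_pow {g g'' : S} {a b N : ℕ} (hb : 0 < b) (hN : a ≤ b * N)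
    (h : g'' - g ∈ maximalIdeal S ^ N) (n : ℕ) :
    ratContactFiltration g'' a b n ≤ ratContactFiltration g a b n := by
  rw [ratContactFiltration_def g'']
  refine iSup_le fun α => ?_
  rw [Ideal.span_singleton_mul_le_iff]
  intro y hy
  set m := g'' - g with hm
  have hg'' : g'' = g + m := by rw [hm, add_sub_cancel]
  rw [hg'', add_pow, Finset.sum_mul]
  refine Ideal.sum_mem _ fun i hi => ?_
  have hiα : i ≤ α := Nat.lt_succ_iff.mp (Finset.mem_range.mp hi)
  have hmy : m ^ (α - i) * (↑(α.choose i) * y) ∈ maximalIdeal S ^ (N * (α - i) + (n - a * α + b - 1) / b) := by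
    rw [pow_add]
    refine Ideal.mul_mem_mul ?_ (Ideal.mul_mem_left _ _ hy)
    rw [pow_mul]
    exact Ideal.pow_mem_pow h _
  have hmono : maximalIdeal S ^ (N * (α - i) + (n - a * α + b - 1) / b) ≤ maximalIdeal S ^ ((n - a * i + b - 1) / b) :=
    Ideal.pow_le_pow_right (by have := ceil_exponent_shift hb hN n hiα; omega)
  have hterm : g ^ i * m ^ (α - i) * ↑(α.choose i) * y ∈
      Ideal.span {g ^ i} * maximalIdeal S ^ ((n - a * i + b - 1) / b) := by
    have : g ^ i * m ^ (α - i) * ↑(α.choose i) * y = g ^ i * (m ^ (α - i) * (↑(α.choose i) * y)) := by ring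
    rw [this]
    exact Ideal.mul_mem_mul (Ideal.mem_span_singleton_self _) (hmono hmy)
  rw [ratContactFiltration_def]
  exact Submodule.mem_iSup_of_mem i hterm

/-- [OURS · R9 · (G2″)] **`𝔪^N`-stability of rational contact**: `g ≡ g″ (mod 𝔪^N)`, `a ≤ bN` ⇒ `RC(g; a,b; n) = RC(g″; a,b; n)`. [folklore] -/
theorem ratContactFiltration_congr_mod_pow {g g'' : S} {a b N : ℕ} (hb : 0 < b) (hN : a ≤ b * N)
    (h : g'' - g ∈ maximalIdeal S ^ N) (n : ℕ) :
    ratContactFiltration g'' a b n = ratContactFiltration g a b n := by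
  refine le_antisymm (ratContactFiltration_le_of_sub_mem_pow hb hN h n)
    (ratContactFiltration_le_of_sub_mem_pow hb hN ?_ n)
  rw [← neg_sub]
  exact Submodule.neg_mem _ h

end Stability

section RatioMonotone

variable {S : Type u} [CommRing S] [IsLocalRing S]

/-- Ceilings are monotone in the ratio: `X'/b' ≤ X/b ⇒ ⌈X'/b'⌉ ≤ ⌈X/b⌉`. [folklore] -/
theorem ceilDiv_mono_ratio {X X' b b' : ℕ} (hb : 0 < b) (hb' : 0 < b') (h : X' * b ≤ X * b') :
    (X' + b' - 1) / b' ≤ (X + b - 1) / b := by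
  set C := (X + b - 1) / b with hC
  have hX : X + b - 1 < C * b + b := Nat.lt_div_mul_add hb
  have h1 : X ≤ C * b := by omega
  have h2 : X' * b ≤ (b' * C) * b := by
    calc X' * b ≤ X * b' := h
      _ ≤ (C * b) * b' := Nat.mul_le_mul_right _ h1
      _ = (b' * C) * b := by ring
  exact Theorems.AQSHeightTwo.cdiv_le_of_le_mul hb' (Nat.le_of_mul_le_mul_right h2 hb)

/-- [OURS · R9] **Rational contact is monotone in the ratio**: `a'/b' ≤ a/b ⇒ RC(g; a,b; aν) ≤ RC(g; a',b'; a'ν)` (reaching a ratio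
reaches every smaller one). [folklore] -/
theorem ratContactFiltration_mono_ratio {g : S} {a b a' b' : ℕ} (hb : 0 < b) (hb' : 0 < b') (h : a' * b ≤ a * b')
    (ν : ℕ) : ratContactFiltration g a b (a * ν) ≤ ratContactFiltration g a' b' (a' * ν) := by
  rw [ratContactFiltration_def, ratContactFiltration_def]
  refine iSup_le fun α => le_trans (Ideal.mul_mono_right (Ideal.pow_le_pow_right ?_))
    (le_iSup (fun α => Ideal.span {g ^ α} * maximalIdeal S ^ ((a' * ν - a' * α + b' - 1) / b')) α)
  rw [← mul_tsub, ← mul_tsub]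
  refine ceilDiv_mono_ratio hb hb' ?_
  calc a' * (ν - α) * b = (a' * b) * (ν - α) := by ring
    _ ≤ (a * b') * (ν - α) := Nat.mul_le_mul_right _ h
    _ = a * (ν - α) * b' := by ring

end RatioMonotone

section Representatives

variable {T : Type u} [CommRing T] [IsRegularLocalRing T]

omit [IsRegularLocalRing T] in
/-- Rational contact only sees `g` up to a unit. [folklore] -/
theorem ratContactFiltration_unit_mul [IsLocalRing T] {v g : T} (hv : IsUnit v) (a b n : ℕ) :
    ratContactFiltration (v * g) a b n = ratContactFiltration g a b n := by
  rw [ratContactFiltration_def, ratContactFiltration_def]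
  refine iSup_congr fun α => ?_
  rw [mul_pow, Ideal.span_singleton_mul_left_unit (hv.pow α)]

/-- [OURS · R9 · (b′) LINEAR REDUCTION] **Only the TRANSLATES `Y − c·t`, `c` from a set of residue REPRESENTATIVES, matter.**  If every
element of `T` is congruent mod `𝔪` to a member of `Λ ⊆ T` (`hres`; at a `k`-rational point `Λ = k`, at a closed point of the curve with residue
field `k[z]/(π)` the polynomials in `z` of degree `< deg π`) and `t, z, Y ∈ 𝔪`, the hypothesis `hW` of `successorRatioBound_of_frames` follows from
its restriction to the regular parameters `Y − c·t`, `c ∈ Λ`: a competitor `g = αt + βz + γY` (`γ` unit, `β ∈ 𝔪`) has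
`γ⁻¹g ≡ Y − c·t (mod 𝔪²)` for the representative `c` of `−α/γ`, §11 with `N = 2` (`A ≤ 2B`) replaces it by that form, and a unit factor is
invisible.  No implicit function, no completion, no Weierstrass, no coefficient field — and the old Step (b) (`no_canceller` for pure-`z`
translations of order `≥ 2`) is not needed either: such translations are invisible below ratio `2`. [folklore] -/
theorem nonmem_of_representatives (Λ : Set T)
    (hres : ∀ x : T, ∃ a ∈ Λ, x - a ∈ maximalIdeal T)
    {t z Y f : T} (ht : t ∈ maximalIdeal T) (hz : z ∈ maximalIdeal T) {ν q ρ : ℕ}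
    (hWlin : ∀ c ∈ Λ, ∀ A B : ℕ, 0 < B → (q + ρ) * B ≤ A * q → A ≤ 2 * B →
      f ∉ ratContactFiltration (Y - c * t) A B (A * ν)) :
    ∀ α β γ : T, IsUnit γ → β ∈ maximalIdeal T → ∀ A B : ℕ, 0 < B → (q + ρ) * B ≤ A * q → A ≤ 2 * B →
      f ∉ ratContactFiltration (α * t + β * z + γ * Y) A B (A * ν) := by
  intro α β γ hγ hβ A B hB hK h2 hmem
  obtain ⟨u, rfl⟩ := hγ
  obtain ⟨c, hcΛ, hc⟩ := hres (-(α * ↑u⁻¹))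
  have hdiff : (Y - c * t) - (↑u⁻¹ * (α * t + β * z + ↑u * Y)) ∈ maximalIdeal T ^ 2 := by
    have : (Y - c * t) - (↑u⁻¹ * (α * t + β * z + ↑u * Y))
        = (-(α * ↑u⁻¹) - c) * t - (β * ↑u⁻¹) * z := by
      linear_combination (-Y) * u.inv_mul
    rw [this, pow_two]
    exact Ideal.sub_mem _ (Ideal.mul_mem_mul hc ht) (Ideal.mul_mem_mul (Ideal.mul_mem_right _ _ hβ) hz)
  have heq := ratContactFiltration_congr_mod_pow hB (show A ≤ B * 2 by omega) hdiff (A * ν)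
  rw [← ratContactFiltration_unit_mul (Units.isUnit u⁻¹) A B (A * ν), ← heq] at hmem
  exact hWlin c hcΛ A B hB hK h2 hmem

omit [IsRegularLocalRing T] in
/-- [OURS · R9] A monomial `t^{e₀} z^{e₁} Y^{e₂}` of `(t,z)`-value `(e₀+e₁)/(ν−e₂) < K = 1 + ρ/q` has `(B,B,A)`-weight `< Aν` for every
ratio `A/B ≥ K`. [folklore] -/
theorem low_weight {q ρ ν A B : ℕ} {e : Fin 3 → ℕ} (hq : 0 < q) (hB : 0 < B) (hK : (q + ρ) * B ≤ A * q)
    (he : q * (e 0 + e 1) < (q + ρ) * (ν - e 2)) : ∑ i, ![B, B, A] i * e i < A * ν := by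
  simp only [Fin.sum_univ_three, Matrix.cons_val_zero, Matrix.cons_val_one, Matrix.cons_val_two, Matrix.tail_cons,
    Matrix.head_cons]
  obtain ⟨m, hm⟩ : ∃ m, ν = e 2 + m := by
    refine ⟨ν - e 2, ?_⟩
    by_contra hne
    have h0 : ν - e 2 = 0 := by omega
    rw [h0, mul_zero] at he
    exact Nat.not_lt_zero _ he
  subst hm
  rw [Nat.add_sub_cancel_left] at he
  have h1 : B * (q * (e 0 + e 1)) < B * ((q + ρ) * m) := (Nat.mul_lt_mul_left hB).mpr he
  have h2 : B * ((q + ρ) * m) ≤ q * (A * m) := by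
    calc B * ((q + ρ) * m) = ((q + ρ) * B) * m := by ring
      _ ≤ (A * q) * m := Nat.mul_le_mul_right _ hK
      _ = q * (A * m) := by ring
  have h3 : q * (B * (e 0 + e 1)) < q * (A * m) := by
    calc q * (B * (e 0 + e 1)) = B * (q * (e 0 + e 1)) := by ring
      _ < q * (A * m) := lt_of_lt_of_le h1 h2
  have h4 : B * (e 0 + e 1) < A * m := (Nat.mul_lt_mul_left hq).mp h3
  have h5 : B * (e 0 + e 1) = B * e 0 + B * e 1 := by ring
  have h6 : A * (e 2 + m) = A * e 2 + A * m := by ring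
  omega

end Representatives

end RatContact

end Iota3

end Summit.ResolutionOfSingularities.ResolutionOfSingularities.Cruxes.HypersurfaceCentreConstruction.LocalEngine
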